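import Mathlib
import Summits.NavierStokesRegularity.NavierStokesRegularity.Theorems.LerayQuarterDissipationFiniteDissipationLiouvilleCriticalProductionBorderlineIff
import Summits.NavierStokesRegularity.NavierStokesRegularity.Theorems.LerayQuarterDissipationFiniteDissipationLiouvilleCrossFlowDss
import Literature.Analysis.FluidPDE.TypeIAncientMildDecay
import HarnessLib

/-!
# Crux `FiniteDissipationLiouville` (stmt-NavierStokesRegularity-22144): CONSTANT-MODULUS VORTICITY PROFILES
# HAVE NO TYPE-I ENVELOPE

Theorems file of route `LerayQuarterDissipation` (lead prover g19; `--supports` the crux; sequel of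
`…CriticalProductionBorderline(Iff)`). Navier–Stokes regularity is NOT proved by anything here; no summit is.

The bare borderline `a = 1` of the critical-production row is equivalent to the non-existence of KNSS-gauge
Type-I fields with `t²‖curl W‖² ≡ M > 0` (`…BorderlineIff`). Such a profile violates every dissipation law
(`…not_law_of_constModulus`). Here: it also has NO TYPE-I ENVELOPE —

* **`not_hasTypeIDecay_of_constModulus`** — if `IsTypeIAncientMild C W` and `t²‖curl W(t,x)‖² = M > 0`
  everywhere, then `HasTypeIDecay A W` fails for every `A`: the class-uniform gradient decay of the enveloped
  class, `(‖x‖ + √(−t))²‖∇W(t,x)‖ ≤ K₁` (Chae–Wolf (3.6), Literature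
  `…exists_forall_pow_mul_norm_iteratedFDeriv_le_of_hasTypeIDecay`), forces `‖curl W(−1,x)‖ → 0` as
  `‖x‖ → ∞`, against `‖curl W(−1,x)‖² = M`;
* (The critical element of the crux is enveloped AND obeys the law; for it lead g18's T58 already settles the
  borderline. The constant-modulus profile produced by `…subsolution_dichotomy` from a general member of the
  bare class is a limit of TRANSLATES and rescalings, so an envelope of the datum does not pass to it.)

So the hypothetical constant-modulus profiles live outside both structured sub-classes of the tree (the
stratum `𝒟` and the enveloped class): law-free, envelope-free, everywhere rotational, everywhere
super-critically stretched, singular at every point of the final slice.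

HONEST FRAMING. A further necessary property of a HYPOTHETICAL object of an open sub-question (law-free,
outside the crux's frame); nothing is removed from the DSS wall (`∀ c>1 TypeIDSSLiouville c`, NECESSARY
for the crux). Nothing here bears on NS regularity.

References: Chae–Wolf, arXiv:1610.09464 §3 (3.6); Koch–Nadirashvili–Seregin–Šverák, Acta Math. 203 (2009) §4.
-/

noncomputable section

set_option linter.dupNamespace false

namespace Summit.NavierStokesRegularity.NavierStokesRegularity.Theorems.FiniteDissipationLiouville.CriticalProduction

open MeasureTheory Set Function Filter Topology TopologicalSpace Metric InnerProductSpace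
open scoped RealInnerProductSpace InnerProductSpace ContDiff
open Literature.Analysis Literature.Analysis.FluidPDE
open Summit.NavierStokesRegularity.NavierStokesRegularity.Theorems
open Summit.NavierStokesRegularity.NavierStokesRegularity.Theorems.FiniteDissipationLiouville.CrossFlow

variable {C : ℝ} {W : ℝ → EuclideanSpace ℝ (Fin 3) → EuclideanSpace ℝ (Fin 3)} {M : ℝ}

/-- **CONSTANT-MODULUS VORTICITY PROFILES HAVE NO TYPE-I ENVELOPE.** See the module docstring.
[cite: ChaeWolf2017RemovingDSS, §3 eq. (3.6) (arXiv:1610.09464 p. 8)] -/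
theorem not_hasTypeIDecay_of_constModulus (hW : IsTypeIAncientMild C W) (hMpos : 0 < M)
    (hM : ∀ t < 0, ∀ x, t ^ 2 * ⟪curl (W t) x, curl (W t) x⟫_ℝ = M) (A : ℝ) :
    ¬ HasTypeIDecay A W := by
  intro hdec
  -- equalise the constants and take the class-uniform gradient decay
  set A' : ℝ := max C A with hA'
  have hW' : IsTypeIAncientMild A' W := isTypeIAncientMild_of_le hW (le_max_left _ _)
  have hdec' : HasTypeIDecay A' W := hasTypeIDecay_of_le hdec (le_max_right _ _)
  obtain ⟨K₁, hK₁0, hK₁⟩ :=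
    IsTypeIAncientMild.exists_forall_pow_mul_norm_iteratedFDeriv_le_of_hasTypeIDecay 1 A'
  -- the slice `t = −1`: `M = ‖curl W(−1,x)‖² ≤ ‖curlCLM‖² ‖∇W(−1,x)‖² ≤ ‖curlCLM‖² K₁² / (‖x‖+1)⁴`
  set L : ℝ := ‖(curlCLM : (EuclideanSpace ℝ (Fin 3) →L[ℝ] EuclideanSpace ℝ (Fin 3)) →L[ℝ]
    EuclideanSpace ℝ (Fin 3))‖ with hL
  have hL0 : 0 ≤ L :=
    norm_nonneg ((curlCLM : (EuclideanSpace ℝ (Fin 3) →L[ℝ] EuclideanSpace ℝ (Fin 3)) →L[ℝ]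
      EuclideanSpace ℝ (Fin 3)))
  have hpt : ∀ x : EuclideanSpace ℝ (Fin 3), M * (‖x‖ + 1) ^ 2 ≤ L * K₁ * Real.sqrt M := by
    intro x
    have hc : ‖curl (W (-1)) x‖ ^ 2 = M := by
      have h := norm_curl_sq_of_constModulus hM (-1) (by norm_num) x
      rw [h]; norm_num
    have hcn : ‖curl (W (-1)) x‖ = Real.sqrt M := by
      rw [← hc, Real.sqrt_sq (norm_nonneg _)]
    have h1 : ‖curl (W (-1)) x‖ ≤ L * ‖fderiv ℝ (W (-1)) x‖ := by
      rw [curl_eq_curlCLM]; exact curlCLM.le_opNorm _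
    have h2 := hK₁ hW' hdec' (-1) (by norm_num) x
    rw [norm_iteratedFDeriv_one, show (-(-1 : ℝ)) = 1 by norm_num, Real.sqrt_one] at h2
    -- `(‖x‖+1)² ‖∇W‖ ≤ K₁` and `√M ≤ L ‖∇W‖`
    have h3 : Real.sqrt M * (‖x‖ + 1) ^ 2 ≤ L * K₁ := by
      have h4 : Real.sqrt M * (‖x‖ + 1) ^ 2 ≤ L * (‖fderiv ℝ (W (-1)) x‖ * (‖x‖ + 1) ^ 2) := by
        rw [← mul_assoc]
        exact mul_le_mul_of_nonneg_right (hcn ▸ h1) (by positivity)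
      have h5 : ‖fderiv ℝ (W (-1)) x‖ * (‖x‖ + 1) ^ 2 ≤ K₁ := by rw [mul_comm]; exact h2
      exact h4.trans (mul_le_mul_of_nonneg_left h5 hL0)
    have hsM : Real.sqrt M * Real.sqrt M = M := Real.mul_self_sqrt hMpos.le
    have hs0 : 0 ≤ Real.sqrt M := Real.sqrt_nonneg _
    calc M * (‖x‖ + 1) ^ 2 = Real.sqrt M * (Real.sqrt M * (‖x‖ + 1) ^ 2) := by rw [← mul_assoc, hsM]
      _ ≤ Real.sqrt M * (L * K₁) := mul_le_mul_of_nonneg_left h3 hs0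
      _ = L * K₁ * Real.sqrt M := by ring
  -- choose `x` far out: `‖x‖ + 1` large
  set R : ℝ := L * K₁ * Real.sqrt M / M + 1 with hR
  have hRpos : 0 ≤ R := by rw [hR]; positivity
  obtain ⟨x, hxn⟩ : ∃ x : EuclideanSpace ℝ (Fin 3), ‖x‖ = R := exists_norm_eq _ hRpos
  have h := hpt x
  rw [hxn] at h
  -- `M (R+1)² ≥ M (R+1) > M R ≥ L K₁ √M`
  have h6 : M * R = L * K₁ * Real.sqrt M + M := by rw [hR]; field_simp
  have h7 : (R + 1) ^ 2 ≥ R + 1 := by nlinarith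
  nlinarith [mul_le_mul_of_nonneg_left h7 hMpos.le]

end Summit.NavierStokesRegularity.NavierStokesRegularity.Theorems.FiniteDissipationLiouville.CriticalProduction

end
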